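import Literature.Computability.Complexity.BPPErrorReduction
import Literature.Computability.Complexity.BPPSubsetAlmostP
import Literature.Computability.Complexity.CodeFPArith
import Literature.Computability.Complexity.UniformProbBlocks
import HarnessLib

/-!
# `BPP` is closed under constant-query truth-table reductions and under finite variations

Trunk toolkit (`Literature/Computability/Complexity`), two closure properties of `BPP = BP·P`
(`ProbabilisticClasses.lean`) that the tree lacked:

* `mem_BPP_of_ttList` — **truth-table closure.** For `K ∈ BPP`, a finite list `Q` of
  polynomial-time query maps and an evaluator `F ∈ P`, the language
  `ttListLang K Q F = {z | ⟨z, [χ_K(q z)]_{q ∈ Q}⟩ ∈ F}` is in `BPP`: amplify `K` to error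
  `1/(3(|Q|+1))` per query (`BPP_subset_bpErr`), answer every query with a PREFIX of one common
  coin string (the events "query `q` is answered wrongly" are cylinder events,
  `uniformProb_take_of_le`), and take the union bound over the `|Q|` queries (no independence is
  needed). This is the textbook remark "`BPP` is closed under polynomial-time truth-table (indeed
  Turing) reductions, `P^BPP = BPP`" in the non-adaptive, constantly-many-queries form
  (Arora–Barak 2009, §7.5.2 / Exercise 7.7 area: "`BPP^BPP = BPP`"; Köbler–Schöning–Torán 1993,
  §4 (closure of `BPP` under `≤ᵖ_tt`)). Corollaries: intersections, unions and Boolean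
  combinations of `FP`-preimages of one `BPP` language (`booleanCombination`-style uses are
  obtained by choosing `F`).
* `mem_BPP_of_eqOn_le` — **`BPP` is invariant under finite variations**: a language agreeing with
  some `K ∈ BPP` on all inputs of length `≥ n₀` is in `BPP` (patch the witness language on the
  finitely many short first components; `shortPart_mem_P`, `setOf_le_length_mem_P`).

The witness language of the truth-table closure is assembled in the typed `CodeFP` algebra
(`CodeFP.lean`, `CodeFPArith.lean`): no machine is written.

## References

* S. Arora, B. Barak, *Computational Complexity: A Modern Approach*, CUP 2009, §7.4.1 (error
  reduction), §7.5.2 ("`BPP^BPP = BPP`", closure under reductions), §A.2 (union bound).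
  [AroraBarakCC2009]
* R. V. Book, H. Vollmer, K. W. Wagner, *Probabilistic type-2 operators and "almost"-classes*,
  1996/1998, §4 ("uniformly invariant under finite variations"). [BookVollmerWagner1996]
-/

namespace Literature.Computability.Complexity

open _root_.Computability Polynomial Brick

/-! ### Small tools -/

/-- Monotonicity of the counting probability (private copy of `PromiseCook.uniformProb_mono`, whose
host file is a heavy import). [cite: AroraBarakCC2009, §A.2] -/
private theorem uniformProb_mono_tt {m : ℕ} {E E' : Set (List Bool)} (h : E ⊆ E') :
    uniformProb m E ≤ uniformProb m E' := by
  classical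
  unfold uniformProb
  refine div_le_div_of_nonneg_right ?_ (by positivity)
  exact_mod_cast Finset.card_le_card fun r hr => by
    simp only [Finset.mem_filter, Finset.mem_univ, true_and] at hr ⊢
    exact h hr

/-- Agreement of memberships gives agreement of indicator bits. [folklore] -/
theorem boolIndicator_congr_of_iff {A B : Set (List Bool)} {a b : List Bool} (h : a ∈ A ↔ b ∈ B) :
    A.boolIndicator a = B.boolIndicator b := by
  by_cases ha : a ∈ A
  · rw [(Set.mem_iff_boolIndicator _ _).1 ha, (Set.mem_iff_boolIndicator _ _).1 (h.1 ha)]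
  · rw [(Set.notMem_iff_boolIndicator _ _).1 ha,
      (Set.notMem_iff_boolIndicator _ _).1 fun hb => ha (h.2 hb)]

/-! ### Truth-table languages -/

section TT

variable (K : Language Bool) (Q : List (List Bool → List Bool)) (F : Language Bool)

/-- The answer bits `[χ_K(q z)]_{q ∈ Q}` of the queries `Q` on input `z`. [folklore] -/
noncomputable def ttListBits (z : List Bool) : List Bool :=
  Q.map fun q => K.boolIndicator (q z)

/-- **The truth-table language** `ttListLang K Q F = {z | ⟨z, ttListBits K Q z⟩ ∈ F}`: evaluate `F` on the
input together with the `K`-answers to the queries `q z`, `q ∈ Q` (a non-adaptive = truth-table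
reduction to `K` with `|Q|` queries and evaluator `F`). [cite: AroraBarakCC2009, §7.5.2] -/
def ttListLang : Language Bool :=
  {z | boolPair z (ttListBits K Q z) ∈ F}

/-- Membership in `ttListLang`. [folklore] -/
@[simp] theorem mem_ttListLang (z : List Bool) : z ∈ ttListLang K Q F ↔ boolPair z (ttListBits K Q z) ∈ F :=
  Iff.rfl

variable (K' : Language Bool) (p'' : Polynomial ℕ)

/-- The answer bits computed from a witness language `K'` of `K` with coins: query `q z` is answered
by `[⟨q z, r ↾ p''(|q z|)⟩ ∈ K']`, every query reading a PREFIX of the same coin string `r`.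
[cite: AroraBarakCC2009, §7.5.2] -/
noncomputable def ttListCoinBits (z r : List Bool) : List Bool :=
  Q.map fun q => K'.boolIndicator (boolPair (q z) (r.take (p''.eval (q z).length)))

/-- **The witness language of `ttListLang`**: `w = ⟨z, r⟩ ↦ [⟨z, ttListCoinBits z r⟩ ∈ F]` (components read off
with the total decoder). [cite: AroraBarakCC2009, §7.5.2] -/
def ttListWit : Language Bool :=
  {w | boolPair (fstF w) (ttListCoinBits Q K' p'' (fstF w) (sndF w)) ∈ F}

/-- Membership of a pair in `ttListWit`. [folklore] -/
@[simp] theorem boolPair_mem_ttListWit (z r : List Bool) :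
    boolPair z r ∈ ttListWit Q F K' p'' ↔ boolPair z (ttListCoinBits Q K' p'' z r) ∈ F := by
  change boolPair (fstF (boolPair z r)) (ttListCoinBits Q K' p'' (fstF (boolPair z r)) (sndF (boolPair z r))) ∈ F ↔ _
  rw [fstF_boolPair, sndF_boolPair]

variable {Q K' p''}

/-- The coin bits are computed on codes: `(z, r) ↦ ttListCoinBits z r` is `CodeFP` for `K' ∈ P` and
polynomial-time queries (induction on the list of queries; each bit is the indicator of `K'` on a
pair assembled by `polyFn`, `strTake`). [cite: AroraBarakCC2009, §1.3] -/
theorem codeFP_ttListCoinBits (hK' : K' ∈ Classes.P) (hQ : ∀ q ∈ Q, q ∈ FP) :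
    CodeFP (CodeFP.pairE CodeFP.strE CodeFP.strE) CodeFP.strE
      (fun zr : List Bool × List Bool => ttListCoinBits Q K' p'' zr.1 zr.2) := by
  induction Q with
  | nil => exact (CodeFP.const _ ([] : List Bool)).congr fun _ => rfl
  | cons q Q ih =>
    have hq : q ∈ FP := hQ q (by simp)
    have ih' := ih fun q' hq' => hQ q' (by simp [hq'])
    -- the query string `q z`
    have hqz : CodeFP (CodeFP.pairE CodeFP.strE CodeFP.strE) CodeFP.strE
        (fun zr : List Bool × List Bool => q zr.1) :=
      (CodeFP.of_fn (eα := CodeFP.strE) (eβ := CodeFP.strE) q hq fun _ => rfl).comp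
        (CodeFP.fst _ _)
    -- the coin prefix length `p''(|q z|)` in unary
    have hpoly : CodeFP CodeFP.strE CodeFP.unE (fun w : List Bool => p''.eval w.length) :=
      CodeFP.of_fn (Plumb.polyFn p'') (Plumb.polyFn_mem_FP p'') fun w => by
        rw [Plumb.polyFn_apply, CodeFP.unE_eq_ones]; rfl
    have htake : CodeFP (CodeFP.pairE CodeFP.strE CodeFP.strE) CodeFP.strE
        (fun zr : List Bool × List Bool => zr.2.take (p''.eval (q zr.1).length)) :=
      CodeFP.strTake.comp ((hpoly.comp hqz).pair (CodeFP.snd _ _))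
    -- the indicator of `K'` on the pair
    have hind : CodeFP (CodeFP.pairE CodeFP.strE CodeFP.strE) CodeFP.bitE
        (fun p : List Bool × List Bool => K'.boolIndicator (boolPair p.1 p.2)) :=
      CodeFP.of_fn (fun x => encodeBool (K'.boolIndicator x)) (indicatorFn_mem_FP hK') fun _ => rfl
    have hbit : CodeFP (CodeFP.pairE CodeFP.strE CodeFP.strE) CodeFP.bitE
        (fun zr : List Bool × List Bool =>
          K'.boolIndicator (boolPair (q zr.1) (zr.2.take (p''.eval (q zr.1).length)))) :=
      hind.comp (hqz.pair htake)
    -- cons of a bit onto a string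
    have hcons : CodeFP (CodeFP.pairE CodeFP.bitE CodeFP.strE) CodeFP.strE
        (fun p : Bool × List Bool => p.1 :: p.2) := by
      have hb : CodeFP CodeFP.bitE CodeFP.strE (fun b : Bool => [b]) :=
        ⟨id, PolyTimeComputable.id _, fun _ => rfl⟩
      exact (CodeFP.strAppend.comp ((hb.comp (CodeFP.fst _ _)).pair (CodeFP.snd _ _))).congr
        fun _ => rfl
    exact (hcons.comp (hbit.pair ih')).congr fun _ => rfl

/-- **`ttListWit ∈ P`** for `K', F ∈ P` and polynomial-time queries: the preimage of `F` under the
`FP` map `w ↦ ⟨fstF w, ttListCoinBits (fstF w) (sndF w)⟩`. [cite: AroraBarakCC2009, §1.3] -/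
theorem ttListWit_mem_P (hK' : K' ∈ Classes.P) (hQ : ∀ q ∈ Q, q ∈ FP) (hF : F ∈ Classes.P) :
    ttListWit Q F K' p'' ∈ Classes.P := by
  have hsplit : CodeFP CodeFP.strE (CodeFP.pairE CodeFP.strE CodeFP.strE)
      (fun w : List Bool => (fstF w, sndF w)) :=
    CodeFP.of_fn rePair rePair_mem_FP fun w => rfl
  obtain ⟨G, hG, hGeq⟩ :=
    (((CodeFP.fst _ _).pair (codeFP_ttListCoinBits (p'' := p'') hK' hQ)).comp hsplit :
      CodeFP CodeFP.strE (CodeFP.pairE CodeFP.strE CodeFP.strE)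
        (fun w : List Bool => (fstF w, ttListCoinBits Q K' p'' (fstF w) (sndF w))))
  have he : ttListWit Q F K' p'' = G ⁻¹' F := by
    ext w
    change boolPair (fstF w) _ ∈ F ↔ G w ∈ F
    rw [show G w = G (CodeFP.strE w) from rfl, hGeq]
    rfl
  rw [he]
  exact preimage_mem_P hF hG

/-- A common polynomial bound on the lengths of the queries. [folklore] -/
theorem exists_poly_queryLen (hQ : ∀ q ∈ Q, q ∈ FP) :
    ∃ S : Polynomial ℕ, ∀ q ∈ Q, ∀ z : List Bool, (q z).length ≤ S.eval z.length := by
  induction Q with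
  | nil => exact ⟨0, fun q hq => by simp at hq⟩
  | cons q Q ih =>
    obtain ⟨s, hs⟩ := exists_poly_length_le_of_mem_FP (hQ q (by simp))
    obtain ⟨S, hS⟩ := ih fun q' hq' => hQ q' (by simp [hq'])
    refine ⟨s + S, fun q' hq' z => ?_⟩
    rw [eval_add]
    rcases List.mem_cons.1 hq' with rfl | hq'
    · exact (hs z).trans (Nat.le_add_right _ _)
    · exact (hS q' hq' z).trans (Nat.le_add_left _ _)

/-- **The union bound over the queries.** If on every query string the coin strings of length
`p''(|query|)` giving the wrong `K'`-verdict have probability `≤ ε`, then for coins of any length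
`m ≥ p''(|q z|)` (all `q ∈ Q`) the probability that SOME coin bit of `ttListCoinBits z r` differs from the
true bit of `ttListBits z` is at most `|Q| · ε` (cylinder events, `uniformProb_take_of_le`; binary union
bound `uniformProb_union_le`, by induction on `Q`). [cite: AroraBarakCC2009, §A.2] -/
theorem uniformProb_ttListCoinBits_ne_le {ε : ℝ}
    (herr : ∀ x : List Bool,
      uniformProb (p''.eval x.length) {y : List Bool | ¬ (boolPair x y ∈ K' ↔ x ∈ K)} ≤ ε)
    {m : ℕ} (z : List Bool) (hm : ∀ q ∈ Q, p''.eval (q z).length ≤ m) :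
    uniformProb m {r : List Bool | ttListCoinBits Q K' p'' z r ≠ ttListBits K Q z} ≤ Q.length * ε := by
  induction Q with
  | nil =>
    have h0 : {r : List Bool | ttListCoinBits [] K' p'' z r ≠ ttListBits K [] z} = ∅ := by
      ext r; simp [ttListCoinBits, ttListBits]
    rw [h0, uniformProb_empty]
    simp
  | cons q Q ih =>
    have ih' := ih (fun q' hq' => hm q' (by simp [hq']))
    set n := p''.eval (q z).length with hn
    set Bad : Set (List Bool) := {r | ¬ (boolPair (q z) (r.take n) ∈ K' ↔ q z ∈ K)} with hBad
    have hsub : {r : List Bool | ttListCoinBits (q :: Q) K' p'' z r ≠ ttListBits K (q :: Q) z} ⊆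
        Bad ∪ {r : List Bool | ttListCoinBits Q K' p'' z r ≠ ttListBits K Q z} := by
      intro r hr
      by_contra hr'
      simp only [Set.mem_union, Set.mem_setOf_eq, not_or, not_not, hBad] at hr'
      apply hr
      change K'.boolIndicator _ :: ttListCoinBits Q K' p'' z r = K.boolIndicator _ :: ttListBits K Q z
      rw [boolIndicator_congr_of_iff hr'.1, hr'.2]
    have hBadle : uniformProb m Bad ≤ ε := by
      have hcyl : Bad = {r : List Bool | r.take n ∈ {y : List Bool | ¬ (boolPair (q z) y ∈ K' ↔ q z ∈ K)}} := by
        ext r; rfl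
      rw [hcyl, uniformProb_take_of_le (hm q (by simp))]
      exact herr (q z)
    calc uniformProb m {r : List Bool | ttListCoinBits (q :: Q) K' p'' z r ≠ ttListBits K (q :: Q) z}
        ≤ uniformProb m (Bad ∪ {r : List Bool | ttListCoinBits Q K' p'' z r ≠ ttListBits K Q z}) :=
          uniformProb_mono_tt hsub
      _ ≤ uniformProb m Bad + uniformProb m {r : List Bool | ttListCoinBits Q K' p'' z r ≠ ttListBits K Q z} :=
          uniformProb_union_le m _ _
      _ ≤ ε + Q.length * ε := add_le_add hBadle ih'
      _ = (q :: Q).length * ε := by simp; ring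

end TT

/-! ### The closure theorems -/

/-- **`BPP` is closed under truth-table reductions with a fixed list of queries.** For `K ∈ BPP`,
polynomial-time query maps `Q` and an evaluator `F ∈ P`, the language
`{z | ⟨z, [χ_K(q z)]_{q ∈ Q}⟩ ∈ F}` is in `BPP`. Proof: error-reduce `K` to `ε = 1/(3(|Q|+1))`
(`BPP_subset_bpErr`), use the witness `ttListWit` with coin polynomial `p'' ∘ S` (`S` a common bound on the
query lengths), and the union bound `uniformProb_ttListCoinBits_ne_le`: with probability `≥ 1 - |Q| ε ≥ 2/3`
all coin bits are the true bits, and then the witness verdict is the truth.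
[cite: AroraBarakCC2009, §7.5.2 (closure of BPP under reductions, BPP^BPP = BPP)] -/
theorem mem_BPP_of_ttList {K : Language Bool} (hK : K ∈ BPP) (Q : List (List Bool → List Bool))
    (hQ : ∀ q ∈ Q, q ∈ FP) {F : Language Bool} (hF : F ∈ Classes.P) : ttListLang K Q F ∈ BPP := by
  -- error reduction
  set ε : ℝ := 1 / (3 * ((Q.length : ℝ) + 1)) with hε
  have hεpos : 0 < ε := by rw [hε]; positivity
  obtain ⟨K', hK', p'', herr⟩ := BPP_subset_bpErr hεpos hK
  -- a common bound on the query lengths, and the coin polynomial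
  obtain ⟨S, hS⟩ := exists_poly_queryLen hQ
  refine ⟨ttListWit Q F K' p'', ttListWit_mem_P (F := F) hK' hQ hF, p''.comp S, fun z => ?_⟩
  set m := (p''.comp S).eval z.length with hm
  have hmq : ∀ q ∈ Q, p''.eval (q z).length ≤ m := fun q hq => by
    rw [hm, eval_comp]
    exact TM2Iter.eval_mono p'' (hS q hq z)
  -- good coins: all coin bits are the true bits
  have hsub : {r : List Bool | ttListCoinBits Q K' p'' z r ≠ ttListBits K Q z}ᶜ ⊆
      {y : List Bool | boolPair z y ∈ ttListWit Q F K' p'' ↔ z ∈ ttListLang K Q F} := by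
    intro r hr
    simp only [Set.mem_compl_iff, Set.mem_setOf_eq, not_not] at hr
    simp only [Set.mem_setOf_eq, boolPair_mem_ttListWit, mem_ttListLang, hr]
  have hbad := uniformProb_ttListCoinBits_ne_le (K := K) herr z hmq
  have hcompl : uniformProb m {r : List Bool | ttListCoinBits Q K' p'' z r ≠ ttListBits K Q z}ᶜ =
      1 - uniformProb m {r : List Bool | ttListCoinBits Q K' p'' z r ≠ ttListBits K Q z} := by
    rw [uniformProb_compl]
  have hQε : (Q.length : ℝ) * ε ≤ 1 / 3 := by
    rw [hε, mul_one_div, div_le_div_iff₀ (by positivity) (by norm_num)]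
    nlinarith [Nat.cast_nonneg (α := ℝ) Q.length]
  calc (2 : ℝ) / 3 ≤ 1 - uniformProb m {r : List Bool | ttListCoinBits Q K' p'' z r ≠ ttListBits K Q z} := by
        linarith
    _ = uniformProb m {r : List Bool | ttListCoinBits Q K' p'' z r ≠ ttListBits K Q z}ᶜ := hcompl.symm
    _ ≤ uniformProb m {y : List Bool | boolPair z y ∈ ttListWit Q F K' p'' ↔ z ∈ ttListLang K Q F} :=
        uniformProb_mono_tt hsub

/-- **Boolean combinations of `FP`-preimages of a `BPP` language are in `BPP`**, in the form most
often used: for `K ∈ BPP`, queries `Q` in `FP` and ANY language `L` whose membership is decided by a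
`P`-evaluator from the input and the answer bits — `z ∈ L ↔ ⟨z, ttListBits K Q z⟩ ∈ F` with `F ∈ P` — we
have `L ∈ BPP`. [cite: AroraBarakCC2009, §7.5.2] -/
theorem mem_BPP_of_ttList' {K L F : Language Bool} (hK : K ∈ BPP) (Q : List (List Bool → List Bool))
    (hQ : ∀ q ∈ Q, q ∈ FP) (hF : F ∈ Classes.P)
    (hL : ∀ z : List Bool, z ∈ L ↔ boolPair z (ttListBits K Q z) ∈ F) : L ∈ BPP := by
  have he : L = ttListLang K Q F := by ext z; exact hL z
  rw [he]
  exact mem_BPP_of_ttList hK Q hQ hF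

/-- **`BPP` is invariant under finite variations**: if `L` agrees with some `K ∈ BPP` on every input of
length `≥ n₀`, then `L ∈ BPP`. The witness language is
`({w | n₀ ≤ |fstF w|} ∩ K') ∪ fstF⁻¹ {x ∈ L | |x| < n₀}` for a witness `K'` of `K`; on a long `x` its
coin sections are those of `K'`, on a short `x` every coin string is correct.
[cite: BookVollmerWagner1996, §4 Thm. 3 (p. 374)] -/
theorem mem_BPP_of_eqOn_le {L K : Language Bool} (hK : K ∈ BPP) (n₀ : ℕ)
    (h : ∀ x : List Bool, n₀ ≤ x.length → (x ∈ L ↔ x ∈ K)) : L ∈ BPP := by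
  obtain ⟨K', hK', p, hp⟩ := hK
  set Long : Language Bool := fstF ⁻¹' ({x : List Bool | n₀ ≤ x.length} : Language Bool) with hLong
  set Short : Language Bool := fstF ⁻¹' ({x : List Bool | x ∈ L ∧ x.length < n₀} : Language Bool)
    with hShort
  have hLongP : Long ∈ Classes.P := preimage_mem_P (setOf_le_length_mem_P n₀) fstF_mem_FP
  have hShortP : Short ∈ Classes.P := preimage_mem_P (shortPart_mem_P L n₀) fstF_mem_FP
  refine ⟨(Long ⊓ K') ⊔ Short, union_mem_P (inter_mem_P hLongP hK') hShortP, p, fun x => ?_⟩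
  have hmem : ∀ y : List Bool, boolPair x y ∈ ((Long ⊓ K') ⊔ Short : Language Bool) ↔
      (n₀ ≤ x.length ∧ boolPair x y ∈ K') ∨ (x ∈ L ∧ x.length < n₀) := fun y => by
    change (fstF (boolPair x y) ∈ ({x : List Bool | n₀ ≤ x.length} : Set (List Bool)) ∧ boolPair x y ∈ K') ∨
      fstF (boolPair x y) ∈ ({x : List Bool | x ∈ L ∧ x.length < n₀} : Set (List Bool)) ↔ _
    rw [fstF_boolPair]
    rfl
  by_cases hn : n₀ ≤ x.length
  · have hset : {y : List Bool | boolPair x y ∈ ((Long ⊓ K') ⊔ Short : Language Bool) ↔ x ∈ L} =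
        {y : List Bool | boolPair x y ∈ K' ↔ x ∈ K} := by
      ext y
      simp only [Set.mem_setOf_eq, hmem y, h x hn]
      constructor
      · intro hy
        constructor
        · intro hyK; exact hy.1 (Or.inl ⟨hn, hyK⟩)
        · intro hxK
          rcases hy.2 hxK with ⟨-, hyK⟩ | ⟨-, hlt⟩
          · exact hyK
          · exact absurd hn (Nat.not_le.2 hlt)
      · intro hy
        constructor
        · rintro (⟨-, hyK⟩ | ⟨-, hlt⟩)
          · exact hy.1 hyK
          · exact absurd hn (Nat.not_le.2 hlt)
        · intro hxK; exact Or.inl ⟨hn, hy.2 hxK⟩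
    rw [hset]
    exact hp x
  · have hlt : x.length < n₀ := Nat.not_le.1 hn
    have hset : {y : List Bool | boolPair x y ∈ ((Long ⊓ K') ⊔ Short : Language Bool) ↔ x ∈ L} =
        Set.univ := by
      ext y
      simp only [Set.mem_setOf_eq, hmem y, Set.mem_univ, iff_true]
      constructor
      · rintro (⟨hn', -⟩ | ⟨hxL, -⟩)
        · exact absurd hn' hn
        · exact hxL
      · intro hxL; exact Or.inr ⟨hxL, hlt⟩
    rw [hset, uniformProb_univ]
    norm_num

end Literature.Computability.Complexity
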